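import Summits.ResolutionOfSingularities.ResolutionOfSingularities.Theorems.EquisingularLiftEquisingularLiftNatDirectionCentre
import Literature.AlgebraicGeometry.Resolution.ControlledTransformLocalModels
import Literature.AlgebraicGeometry.Resolution.BlowupChartRatios
import Literature.AlgebraicGeometry.Resolution.BlowupAlgebraQuasiRegularChart
import Literature.AlgebraicGeometry.Resolution.BlowupLiftsCongruence
import Literature.AlgebraicGeometry.Resolution.BlowupDisjointCentreSplitting
import HarnessLib

/-!
# [OURS · L1 W4.5(b) · EL♮(3) (L) brick C2, sub-brick B1a] The chart of a direction round over an adapted affine frame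

Cell res-hironaka, LADDER-RESOLUTION rung L, slot W4.5(b), crux chain w45b: EL♮(3) = stmt-ResolutionOfSingularities-20148, brick C2 of
`Tower.hLift_of_bricks` (res-L1-w45b-stub-4 skeleton e8194db888c4f60c; census `Cruxes/EquisingularLiftNatThree/Lines/C2-CENSUS-res-type-027.md`,
desk ruling res-L1-w45b-plan-1 2026-08-27T23:27:38Z «C2 AS TYPED»). Seat res-type-027 g15. `--supports stmt-ResolutionOfSingularities-20148 --as helper`.
OURS; NOT a statement of any manuscript; AI-written, weaker than expert review. Definition-free; standard axioms.

SETTING (the root round of the socket, G₀-side only): `υ : G₁ ⟶ G₀` a blowing up along the carrier trace `Ī` (`= 𝓘⟨Z₀⟩`), a direction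
`𝒟'` (`Ī² ≤ 𝒟' ≤ Ī`), and an ADAPTED AFFINE FRAME (sub-brick B1′, res-L1-w45b-stub-3): an affine `W ⊆ G₀` with `c₀, c₁ ∈ Γ(G₀, W)`,
`Ī(W) = (c₀, c₁)`, `c` quasi-regular, `𝒟'(W) = (c₀) + Ī(W)²`. On the principal chart `V := G₁[W, c₁]` (tree `blowupChart`; affine,
`g := υ^*c₁` a regular generator of `Ī·𝒪_{G₁}`):
* `ideal_controlledTransform_direction_chart` — the section `Γ̃₁ = V(σᶜ(𝒟', 1))` of the exceptional `ℙ¹`-bundle is cut out on `V` by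
  `(T, g)`, `T = c₀/c₁` the chart ratio (`g·T = υ^*c₀`): `σᶜ(𝒟',1)(V) = (T) + (g)`;
* `mem_blowupChart_of_mem_support_controlledTransform_direction` — `Γ̃₁ ∩ υ⁻¹W ⊆ V` (on the other chart `G₁[W, c₀]` the controlled
  transform is the unit ideal);
* `mem_span_of_chartRatio_mul_mem_span` — `T` is a non-zero-divisor modulo `g`: `E₁ ∩ V ≅ Spec (Γ(W)/Ī(W))[T]`
  (tree `blowupAlgebraQuotEquiv`, Stacks 0BIQ), so the ideal `(T̄)` of `Γ̃₁ ∩ V` in `Ẽ₁ ∩ V` is generated by a regular element — the input of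
  the conormal frame of sub-brick B1b.
[cite: StacksProject, Tag 0804; StacksProject, Tag 0BIQ; GortzWedhorn2020, (13.19), Prop. 13.96] [cite: BierstoneGrigorievMilmanWlodarczyk2011, §3.2]
-/

set_option linter.dupNamespace false

noncomputable section

open CategoryTheory CategoryTheory.Limits AlgebraicGeometry TopologicalSpace Opposite
open Literature.AlgebraicGeometry.Resolution
open AlgebraicGeometry.Scheme.IdealSheafData

namespace Summit.ResolutionOfSingularities.ResolutionOfSingularities.Cruxes.EquisingularLiftNat.Sections

universe u

/-! ## Ring lemmas -/

/-- `(a) + (g)² = (a) + (g·g)`. [folklore] -/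
theorem span_singleton_sup_sq (R : Type u) [CommRing R] (a g : R) :
    Ideal.span {a} ⊔ Ideal.span {g} ^ 2 = Ideal.span {a} ⊔ Ideal.span {g * g} := by
  rw [Ideal.span_singleton_pow, pow_two]

/-- In `(R/I)[X_j : j ≠ i]` a variable is a non-zero-divisor. [folklore] -/
theorem eq_zero_of_X_mul_eq_zero {σ : Type*} {R : Type*} [CommRing R] (j : σ) {p : MvPolynomial σ R} (h : MvPolynomial.X j * p = 0) :
    p = 0 :=
  (MvPolynomial.isRegular_X (R := R) (n := j) : IsRegular (MvPolynomial.X j)).left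
    (show MvPolynomial.X j * p = MvPolynomial.X j * 0 by rw [h, mul_zero])

/-! ## The chart of the round -/

section Chart

variable {G₁ G₀ : Scheme.{u}} {υ : G₁ ⟶ G₀} {Ī : G₀.IdealSheafData}

/-- The two generators lie in `Ī(W)`. [folklore] -/
theorem mem_ideal_of_span_range_eq (W : G₀.affineOpens) (c : Fin 2 → Γ(G₀, (W : G₀.Opens)))
    (hc : Ideal.span (Set.range c) = Ī.ideal W) (j : Fin 2) : c j ∈ Ī.ideal W :=
  hc ▸ Ideal.subset_span ⟨j, rfl⟩

/-- On the chart `G₁[W, c₁]` the inverse image ideal `Ī·𝒪_{G₁}` is generated by the regular element `g = υ^*c₁`. [cite: StacksProject, Tag 0804] -/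
theorem ideal_comap_blowupChart_eq_span (hυ : IsBlowup υ Ī) (W : G₀.affineOpens) (c : Fin 2 → Γ(G₀, (W : G₀.Opens)))
    (hc1 : c 1 ∈ Ī.ideal W) :
    (Ī.comap υ).ideal ⟨blowupChart υ Ī W (c 1), hυ.isAffineOpen_blowupChart hc1⟩ =
        Ideal.span {υ.appLE W (blowupChart υ Ī W (c 1)) (blowupChart_le_preimage υ Ī W (c 1)) (c 1)} ∧
      υ.appLE W (blowupChart υ Ī W (c 1)) (blowupChart_le_preimage υ Ī W (c 1)) (c 1) ∈
        nonZeroDivisors Γ(G₁, blowupChart υ Ī W (c 1)) := by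
  obtain ⟨h, hnzd, hideal⟩ := hυ.isPrincipalChart_blowupChart (U := W) hc1
  exact ⟨hideal, hnzd⟩

/-- **The direction centre on the chart `c₁`, on sections.** With `T` the chart ratio (`g·T = υ^*c₀`, `g = υ^*c₁`) and
`𝒟'(W) = (c₀) + Ī(W)²`: `σᶜ(𝒟', 1)(G₁[W, c₁]) = (T) + (g)` — the total transform is `(gT) + (g²) = g·((T) + (g))` and `g` is regular.
[cite: BierstoneGrigorievMilmanWlodarczyk2011, §3.2; StacksProject, Tag 0804] -/
theorem ideal_controlledTransform_direction_chart [IsLocallyNoetherian G₁] (hυ : IsBlowup υ Ī) (𝒟' : G₀.IdealSheafData)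
    (W : G₀.affineOpens) (c : Fin 2 → Γ(G₀, (W : G₀.Opens))) (hc1 : c 1 ∈ Ī.ideal W)
    (h𝒟 : 𝒟'.ideal W = Ideal.span {c 0} ⊔ (Ī.ideal W) ^ 2)
    (T : Γ(G₁, blowupChart υ Ī W (c 1)))
    (hT : υ.appLE W (blowupChart υ Ī W (c 1)) (blowupChart_le_preimage υ Ī W (c 1)) (c 1) * T =
      υ.appLE W (blowupChart υ Ī W (c 1)) (blowupChart_le_preimage υ Ī W (c 1)) (c 0)) :
    (controlledTransform υ Ī 𝒟' 1).ideal ⟨blowupChart υ Ī W (c 1), hυ.isAffineOpen_blowupChart hc1⟩ =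
      Ideal.span {T} ⊔ Ideal.span {υ.appLE W (blowupChart υ Ī W (c 1)) (blowupChart_le_preimage υ Ī W (c 1)) (c 1)} := by
  obtain ⟨hideal, hnzd⟩ := ideal_comap_blowupChart_eq_span hυ W c hc1
  set V : G₁.affineOpens := ⟨blowupChart υ Ī W (c 1), hυ.isAffineOpen_blowupChart hc1⟩ with hVdef
  set φ := υ.appLE W (blowupChart υ Ī W (c 1)) (blowupChart_le_preimage υ Ī W (c 1)) with hφ
  set g := φ (c 1) with hg
  have hĪ : (Ī.ideal W).map φ.hom = Ideal.span {g} := by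
    rw [← ideal_comap_of_le υ Ī W V (blowupChart_le_preimage υ Ī W (c 1))]
    exact hideal
  rw [ideal_controlledTransform_of_span_eq W V (blowupChart_le_preimage υ Ī W (c 1)) (c 1) hideal 𝒟' 1, pow_one, h𝒟, Ideal.map_sup,
    Ideal.map_pow, hĪ, Ideal.map_span, Set.image_singleton, span_singleton_sup_sq]
  change (Ideal.span {φ (c 0)} ⊔ Ideal.span {g * g}).colon {g} = _
  rw [← hT]
  exact (Submodule.colon_span (N := Ideal.span {g * T} ⊔ Ideal.span {g * g}) (S := {g})).symm.trans
    (colon_span_pair_mul_eq hnzd T)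

/-- **The direction centre misses the chart `c₀`, on sections**: `σᶜ(𝒟', 1)(G₁[W, c₀]) = ⊤` (`υ^*c₀ ∈ υ^*𝒟'` is the exceptional generator there).
[cite: StacksProject, Tag 0804] -/
theorem ideal_controlledTransform_direction_chart_zero [IsLocallyNoetherian G₁] (hυ : IsBlowup υ Ī) (𝒟' : G₀.IdealSheafData)
    (W : G₀.affineOpens) (c : Fin 2 → Γ(G₀, (W : G₀.Opens))) (hc0 : c 0 ∈ Ī.ideal W)
    (h𝒟 : 𝒟'.ideal W = Ideal.span {c 0} ⊔ (Ī.ideal W) ^ 2) :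
    (controlledTransform υ Ī 𝒟' 1).ideal ⟨blowupChart υ Ī W (c 0), hυ.isAffineOpen_blowupChart hc0⟩ = ⊤ := by
  obtain ⟨h, hnzd, hideal⟩ := hυ.isPrincipalChart_blowupChart (U := W) hc0
  set V : G₁.affineOpens := ⟨blowupChart υ Ī W (c 0), hυ.isAffineOpen_blowupChart hc0⟩ with hVdef
  rw [ideal_controlledTransform_of_span_eq W V (blowupChart_le_preimage υ Ī W (c 0)) (c 0) hideal 𝒟' 1, pow_one, Ideal.eq_top_iff_one,
    Submodule.mem_colon_singleton, smul_eq_mul, one_mul]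
  exact Ideal.mem_map_of_mem _ (h𝒟 ▸ Ideal.mem_sup_left (Ideal.mem_span_singleton_self _))

/-- **`Γ̃₁ ∩ υ⁻¹W ⊆ G₁[W, c₁]`**: a point of the support of the direction centre lying over `W` is in the chart `c₁` (the two charts cover `υ⁻¹W`
and the centre misses the chart `c₀`). [cite: StacksProject, Tag 0804] -/
theorem mem_blowupChart_of_mem_support_controlledTransform_direction [IsLocallyNoetherian G₁] (hυ : IsBlowup υ Ī)
    (𝒟' : G₀.IdealSheafData) (W : G₀.affineOpens) (c : Fin 2 → Γ(G₀, (W : G₀.Opens))) (hc : Ideal.span (Set.range c) = Ī.ideal W)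
    (h𝒟 : 𝒟'.ideal W = Ideal.span {c 0} ⊔ (Ī.ideal W) ^ 2) {y : G₁}
    (hy : y ∈ (controlledTransform υ Ī 𝒟' 1).support) (hyW : υ y ∈ (W : G₀.Opens)) :
    y ∈ blowupChart υ Ī W (c 1) := by
  have hc0 : c 0 ∈ Ī.ideal W := mem_ideal_of_span_range_eq W c hc 0
  have hcov := hυ.iSup_blowupChart (U := W) c hc
  have hy' : y ∈ ⨆ k, blowupChart υ Ī W (c k) := by rw [hcov]; exact hyW
  obtain ⟨k, hk⟩ := Opens.mem_iSup.mp hy'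
  fin_cases k
  · exfalso
    let V₀ : G₁.affineOpens := ⟨blowupChart υ Ī W (c 0), hυ.isAffineOpen_blowupChart hc0⟩
    have hk' : y ∈ (V₀ : G₁.Opens) := hk
    have htop : (controlledTransform υ Ī 𝒟' 1).ideal V₀ = ⊤ := ideal_controlledTransform_direction_chart_zero hυ 𝒟' W c hc0 h𝒟
    have hz := (Scheme.IdealSheafData.mem_support_iff_of_mem (I := controlledTransform υ Ī 𝒟' 1) (U := V₀) hk').mp hy
    rw [htop, Scheme.mem_zeroLocus_iff] at hz
    exact hz 1 trivial (by rw [Scheme.basicOpen_one]; exact hk')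
  · exact hk

set_option maxHeartbeats 400000 in -- one quotient of the chart algebra (a subalgebra of a localisation): slow unification, cf. …NatAxisStalks
/-- **`T = c₀/c₁` is a non-zero-divisor modulo `g = υ^*c₁`** on the chart `G₁[W, c₁]` (`c` quasi-regular): under
`Γ(G₁, G₁[W, c₁]) ≅ Γ(W)[Ī(W)/c₁]` and `Γ(W)[Ī(W)/c₁]/(c₁) ≅ (Γ(W)/Ī(W))[X]` (Stacks 0BIQ) `T ↦ X`, a regular element.
[cite: StacksProject, Tag 0BIQ; StacksProject, Tag 0804] -/
theorem mem_span_of_chartRatio_mul_mem_span (hυ : IsBlowup υ Ī) (W : G₀.affineOpens) (c : Fin 2 → Γ(G₀, (W : G₀.Opens)))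
    (hc : Ideal.span (Set.range c) = Ī.ideal W) (hqr : IsQuasiRegular c) (T : Γ(G₁, blowupChart υ Ī W (c 1)))
    (hT : υ.appLE W (blowupChart υ Ī W (c 1)) (blowupChart_le_preimage υ Ī W (c 1)) (c 1) * T =
      υ.appLE W (blowupChart υ Ī W (c 1)) (blowupChart_le_preimage υ Ī W (c 1)) (c 0))
    (a : Γ(G₁, blowupChart υ Ī W (c 1)))
    (ha : T * a ∈ Ideal.span {υ.appLE W (blowupChart υ Ī W (c 1)) (blowupChart_le_preimage υ Ī W (c 1)) (c 1)}) :
    a ∈ Ideal.span {υ.appLE W (blowupChart υ Ī W (c 1)) (blowupChart_le_preimage υ Ī W (c 1)) (c 1)} := by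
  classical
  have hc0 : c 0 ∈ Ī.ideal W := mem_ideal_of_span_range_eq W c hc 0
  have hc1 : c 1 ∈ Ī.ideal W := mem_ideal_of_span_range_eq W c hc 1
  -- the chart ring as the affine blowup algebra `B = Γ(W)[(c₀, c₁)/c₁]`
  obtain ⟨e, he⟩ : ∃ e : Γ(G₁, blowupChart υ Ī W (c 1)) ≃+* blowupAlgebra (Ideal.span (Set.range c)) (c 1),
      ∀ s, e (υ.appLE W (blowupChart υ Ī W (c 1)) (blowupChart_le_preimage υ Ī W (c 1)) s) =
        algebraMap _ (blowupAlgebra (Ideal.span (Set.range c)) (c 1)) s := by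
    rw [hc]
    exact hυ.exists_ringEquiv_blowupChart W hc1
  have hz : algebraMap _ (blowupAlgebra (Ideal.span (Set.range c)) (c 1)) (c 1) ∈
      nonZeroDivisors (blowupAlgebra (Ideal.span (Set.range c)) (c 1)) := algebraMap_mem_nonZeroDivisors_blowupAlgebra
  -- `e T = c₀/c₁`
  have heT : e T = blowupAlgebra.frac c 1 0 := by
    have h1 : algebraMap _ (blowupAlgebra (Ideal.span (Set.range c)) (c 1)) (c 0) =
        algebraMap _ (blowupAlgebra (Ideal.span (Set.range c)) (c 1)) (c 1) * e T := by
      rw [← he (c 0), ← hT, map_mul, he]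
    have h2 := (blowupAlgebra.algebraMap_mul_gen (Ideal.span (Set.range c)) (c 1) (c 0) (blowupAlgebra.mem_span_range c 0)).trans h1
    exact ((mul_cancel_left_mem_nonZeroDivisors hz).mp h2).symm
  -- modulo `c₁`, `B/(c₁) ≅ (Γ(W)/Ī(W))[X]` with `c₀/c₁ ↦ X` (Stacks 0BIQ): `X · p = 0 ⇒ p = 0`
  obtain ⟨b, hb⟩ := Ideal.mem_span_singleton'.mp ha
  -- `b · c₁ = T · a` read in `B`, then modulo `c₁`
  have h3 : e b * algebraMap _ (blowupAlgebra (Ideal.span (Set.range c)) (c 1)) (c 1) = e T * e a := by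
    rw [← he (c 1), ← e.map_mul, ← e.map_mul, hb]
  have h4 : Ideal.Quotient.mk (Ideal.span {algebraMap _ (blowupAlgebra (Ideal.span (Set.range c)) (c 1)) (c 1)}) (e T) *
      Ideal.Quotient.mk (Ideal.span {algebraMap _ (blowupAlgebra (Ideal.span (Set.range c)) (c 1)) (c 1)}) (e a) = 0 := by
    rw [← RingHom.map_mul, ← h3, RingHom.map_mul, Ideal.Quotient.eq_zero_iff_mem.mpr (Ideal.mem_span_singleton_self _), mul_zero]
  -- read in the polynomial ring `(Γ(W)/Ī(W))[X]`
  have hTX : Ideal.Quotient.mk (Ideal.span {algebraMap _ (blowupAlgebra (Ideal.span (Set.range c)) (c 1)) (c 1)}) (e T) =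
      blowupAlgebraQuotEquiv c 1 hqr (MvPolynomial.X ⟨0, by decide⟩) :=
    (congrArg (Ideal.Quotient.mk _) heT).trans (blowupAlgebraQuotEquiv_X c 1 hqr ⟨0, by decide⟩).symm
  have h4' : blowupAlgebraQuotEquiv c 1 hqr (MvPolynomial.X ⟨0, by decide⟩) *
      Ideal.Quotient.mk (Ideal.span {algebraMap _ (blowupAlgebra (Ideal.span (Set.range c)) (c 1)) (c 1)}) (e a) = 0 := hTX ▸ h4
  have h5 : blowupAlgebraQuotEquiv c 1 hqr (MvPolynomial.X ⟨0, by decide⟩ * (blowupAlgebraQuotEquiv c 1 hqr).symm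
      (Ideal.Quotient.mk (Ideal.span {algebraMap _ (blowupAlgebra (Ideal.span (Set.range c)) (c 1)) (c 1)}) (e a))) = 0 := by
    have hm := (blowupAlgebraQuotEquiv c 1 hqr).map_mul (MvPolynomial.X ⟨0, by decide⟩) ((blowupAlgebraQuotEquiv c 1 hqr).symm
      (Ideal.Quotient.mk (Ideal.span {algebraMap _ (blowupAlgebra (Ideal.span (Set.range c)) (c 1)) (c 1)}) (e a)))
    simp only [RingEquiv.apply_symm_apply] at hm
    exact hm.trans h4'
  have hp0 := eq_zero_of_X_mul_eq_zero _
    ((blowupAlgebraQuotEquiv c 1 hqr).injective (h5.trans (blowupAlgebraQuotEquiv c 1 hqr).map_zero.symm))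
  have hq0 : Ideal.Quotient.mk (Ideal.span {algebraMap _ (blowupAlgebra (Ideal.span (Set.range c)) (c 1)) (c 1)}) (e a) = 0 :=
    calc _ = blowupAlgebraQuotEquiv c 1 hqr ((blowupAlgebraQuotEquiv c 1 hqr).symm
          (Ideal.Quotient.mk (Ideal.span {algebraMap _ (blowupAlgebra (Ideal.span (Set.range c)) (c 1)) (c 1)}) (e a))) :=
            ((blowupAlgebraQuotEquiv c 1 hqr).apply_symm_apply _).symm
      _ = blowupAlgebraQuotEquiv c 1 hqr 0 := congrArg (blowupAlgebraQuotEquiv c 1 hqr) hp0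
      _ = 0 := (blowupAlgebraQuotEquiv c 1 hqr).map_zero
  obtain ⟨b', hb'⟩ := Ideal.mem_span_singleton'.mp (Ideal.Quotient.eq_zero_iff_mem.mp hq0)
  -- pull back along `e`
  refine Ideal.mem_span_singleton'.mpr ⟨e.symm b', e.injective ?_⟩
  rw [e.map_mul, e.apply_symm_apply, he, hb']

end Chart

end Summit.ResolutionOfSingularities.ResolutionOfSingularities.Cruxes.EquisingularLiftNat.Sections

end
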